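import Summits.BirchSwinnertonDyer.BirchSwinnertonDyer.Theorems.SignedLowerHalvesSprungLowerDivisibilityAtThreeIotaDoorStubs
import Summits.BirchSwinnertonDyer.BirchSwinnertonDyer.Theorems.SignedLowerHalvesSprungLowerDivisibilityAtThreeSqueezeToCommonZerosContra
import Literature.NumberTheory.EllipticCurves.Sprung2012.SharpFlatColemanKatoContragredient
import HarnessLib

/-!
# Crux `SprungLowerDivisibilityAtThree` (item stmt-BirchSwinnertonDyer-19875), line `chromatic-common-zeros`: THE `ι`-DOOR IN PRINT KEYING
# (C′ twin, part 1) — the content identity, the door at one prime and the off-`(T)` composition `k(𝔭) ≤ x′(𝔭)` over the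
# CONTRAGREDIENT joint package `Cs, Cf : SharpFlatColemanKatoDataContra … I` and a NATURAL-keyed fine dual datum `Y′ : FineSelmerDualData κ γ⁻¹`

Cell `bsd-ssimc` (host), width seat `cruxlead-stmt-BirchSwinnertonDyer-19875-w3` (gen 9) under the 19875 LEAD (LEAD g6 GO 21:27:28Z:
«the ι-door / ledger-family Contra twin is yours»; conclusion texts = the γ-keyed bodies with exactly the substitutions
`Cs Cf : SharpFlatColemanKatoDataContra`, `Y′ : W.FineSelmerDualData κ γ⁻¹`); `--supports` stmt-BirchSwinnertonDyer-19875 `--as helper`;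
theorems only (no `def`, no named fact, no instance); closes NO item. TWIN, token for token up to those substitutions, of the LEAD g5
files `…IotaDoor.lean` (p657347) §1–§2; the pair (K_spor′, S4b-cyc′) and the assembly with the discharged F-α♮′ are the companion
`…IotaDoorContraStubs.lean`. HONEST FRAMING: a literal case split over landed ledger lemmas; nothing is discharged here; K_spor′, S4b-cyc′,
C′, K1, leaf X8 and BSD are NOT proved by anything in this file; the residue R♮′ is the Eisenstein (⊆) half of Kato 2004 Conj. 12.10 /
Sprung 2012 Main Conj. 7.21 on `{j(ι𝔭) < k(𝔭)}`, OPEN in print at `(3, a₃ = ±3)`.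

KEYING (why the door keeps ITS SHAPE in print keying; ref g25 R-283, lit g58 T73, LEAD g5 memo KEYING-g5). Natural keying: covariant
`I` (`T = conj_γ − 1`), duals keyed `γ⁻¹`, packages `SharpFlatColemanKatoDataContra` (contra-ty, p662311). Notation at a height-one `𝔮`:
`k(𝔮) = ℓ_𝔮(I.H ⧸ Cs.Z)`, `c^•(𝔮) = ℓ_𝔮(Λ ⧸ range C•.colMap)`, `j(𝔮) = min(c♯, c♭)(𝔮)`, `m^•(𝔮) = ℓ_𝔮 Λ/(G^•)`, `x′(𝔮) = ℓ_𝔮 Y′.X`.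
K_spor′ at `𝔭` reads `k(𝔭) ≤ x′(𝔭)` (Kato 12.10 ⊆ at the SAME prime — print). F-α♮′ (w2 g9/g10 `cokerBoundIotaOffT_contra_of_poitouTate`,
from `thm714seq_sharpFlat_poitouTate_functionalModel` + Kato 12.4 + Matar) reads `j(𝔮) ≤ x′(ι𝔮)` — the `ι` is MATAR'S DOT
(`Ṫ_Λ(X) ∼ X₀`), not a keying artefact. Hence the door at `𝔭` uses F-α♮′ at the MIRROR prime `𝔮 = ι𝔭` (`ιι𝔭 = 𝔭`):
«`k(𝔭) ≤ j(ι𝔭)` ⟹ `k(𝔭) ≤ x′(𝔭)`», and the residue is R♮′ = `{j(ι𝔭) < k(𝔭)}` — exactly the γ-keyed door's shape with `Y′` for `Y`. At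
`ι`-fixed primes (all positive-level cyclotomic primes, `comap_invol_eq_self_of_cyclotomic_comp_mem`) the dot disappears.

* §1 `SharpFlatColemanKatoDataContra.lengthAt_quotient_span_eq_zeta_add_range` (content identity `m^• = k + c^•`, from the Contra package's
  `image_zeta_localized` + `colMap_injective` — the SAME fields as the γ-keyed package), `…_zeta_le_…`, `…_zeta_ne_top`.
* §2 `localIndex_eq_zero_of_normalised_not_mem_contra`, `katoFineLowerAt_of_iotaDoor_contra`, `…_of_comap_invol_eq`.
* §3 `katoFineLowerOffT_of_iotaDoor_contra (hFα′) (hres′)` — `k ≤ x′` at every height-one common zero `𝔭 ∌ p, T`; `hFα′` = the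
  conclusion text of `cokerBoundIotaOffT_contra_of_poitouTate` VERBATIM, `hres′` = R♮′.

References: [Kato2004Asterisque] Conj. 12.10 (p. 224), Thm. 12.5/12.6 (p. 222), (17.13.1) (p. 280); [Sprung2012] Def. 6.1, §7.1 Props. 7.3/7.6,
Thm. 7.14 (3), Thm. 7.16 (p. 1504), Prop. 7.19, Main Conj. 7.21 (p. 1505); [Matar2020] Thm. 1.1 (the dot); [Wingberg1989] Cor. 2.5;
[KuriharaPollack2007] Prop. 1.2; tree: `…IotaDoor[Stubs]` (γ-keyed twin), `…SqueezeToCommonZerosContra` (LEAD g6: `SharpFlatColemanKatoDataContra.lengthAt_add_eq`),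
`Sprung2012/SharpFlatColemanKatoContragredient` (contra-ty), `…CokerBoundByMassContraPoitouTate` (w2: F-α♮′).
-/

set_option linter.dupNamespace false
set_option autoImplicit false

noncomputable section

open scoped Classical NumberField MatrixGroups ModularForm Polynomial

open NumberField IsDedekindDomain CongruenceSubgroup WeierstrassCurve Field
  Literature.NumberTheory.EllipticCurves Literature.NumberTheory.EllipticCurves.ModularForms
  Literature.NumberTheory.EllipticCurves.ZpExtension Literature.NumberTheory.EllipticCurves.Sprung2017
  Literature.NumberTheory.EllipticCurves.Sprung2012 Literature.NumberTheory.EllipticCurves.Rank1Residual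
  Literature.NumberTheory.EllipticCurves.IwasawaAlgebra Literature.NumberTheory.EllipticCurves.Kato2004
  Literature.NumberTheory.EllipticCurves.Module
  Summit.BirchSwinnertonDyer.BirchSwinnertonDyer.Theorems
  Summit.BirchSwinnertonDyer.BirchSwinnertonDyer.Theorems.SmallImageSignedMuDefect

namespace Summit.BirchSwinnertonDyer.BirchSwinnertonDyer.Theorems.ChromaticCommonZeros

/-! ### §1 The content identity `m^• = k + c^•` for the contragredient package -/

section Package

variable (W : WeierstrassCurve ℚ) [W.IsElliptic] (p : ℕ) [Fact p.Prime]
  [ContinuousSMul ℤ_[p] (W.tateModule p)] [Module.Free ℤ_[p] (W.tateModule p)]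
  [Module.Finite ℤ_[p] (W.tateModule p)]
  {N : ℕ} {f : CuspForm (Gamma0 N) 2} {ϖ : ℚ} {κ : ZpExtension ℚ p} {γ : absoluteGaloisGroup ℚ}
  {E : Type} [Field E] [Algebra ℚ E] {ι : AlgebraicClosure ℚ →ₐ[ℚ] AlgebraicClosure E} {ap : ℤ}
  {g : absoluteGaloisGroup E} {c : ℕ → localPoints W E} {I : IwasawaH1Data W p κ γ}

/-- **Content identity, print keying: `ℓ_𝔭 Λ/(G₁) = ℓ_𝔭(𝐇¹/Z) + ℓ_𝔭(Λ/range colMap)`** (`m^• = k + c^•`) for a contragredient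
package `C` of colour `•` with `L^• ≠ 0`, `E[p]` irreducible, Néron normalisation `ι G₁ = C(ϖ)·ι L^•`, at every height-one `𝔭`. Twin of
`SharpFlatColemanKatoData.lengthAt_quotient_span_eq_zeta_add_range` (same proof: the fields `image_zeta_localized`, `colMap_injective`, `Z`
are common to both packages). [cite: Sprung2012, Def. 6.1 (p. 1495), Thm. 7.14 (3) (p. 1504)] [cite: Kato2004Asterisque, Thm. 12.6 (p. 222)] -/
theorem _root_.Literature.NumberTheory.EllipticCurves.Sprung2012.SharpFlatColemanKatoDataContra.lengthAt_quotient_span_eq_zeta_add_range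
    {col : Chroma} (C : SharpFlatColemanKatoDataContra W p f ϖ κ γ ι ap g c col I)
    (hirr : W.HasIrreducibleModPGaloisRep p) {Lsharp Lflat G₁ : IwasawaAlgebra p}
    (hSP : IsSprungPair f p ap Lsharp Lflat) (hcol : chromaticL col Lsharp Lflat ≠ 0)
    (hG₁ : iwasawaToPowerSeries p G₁ =
      PowerSeries.C ((ϖ : ℚ) : ℚ_[p]) * iwasawaToPowerSeries p (chromaticL col Lsharp Lflat))
    (𝔭 : PrimeSpectrum (IwasawaAlgebra p)) (h𝔭 : 𝔭.asIdeal.height = 1) :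
    lengthAt (IwasawaAlgebra p) (IwasawaAlgebra p ⧸ Ideal.span {G₁}) 𝔭 =
      lengthAt (IwasawaAlgebra p) (I.H ⧸ C.Z) 𝔭 +
        lengthAt (IwasawaAlgebra p) (IwasawaAlgebra p ⧸ LinearMap.range C.colMap) 𝔭 := by
  obtain ⟨s, hs, hsG, hZG⟩ := C.image_zeta_localized hirr Lsharp Lflat G₁ hSP hG₁ 𝔭 h𝔭
  have hMG : lengthAt (IwasawaAlgebra p) (IwasawaAlgebra p ⧸ Submodule.map C.colMap C.Z) 𝔭 =
      lengthAt (IwasawaAlgebra p) (IwasawaAlgebra p ⧸ Ideal.span {G₁}) 𝔭 := by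
    refine lengthAt_quotient_eq_of_smul_mem (Submodule.map C.colMap C.Z) (Ideal.span {G₁}) 𝔭 hs ?_ ?_
    · intro x hx
      obtain ⟨a, rfl⟩ := Ideal.mem_span_singleton'.mp hx
      rw [smul_eq_mul, ← mul_assoc, mul_comm s a, mul_assoc]
      exact Ideal.mul_mem_left _ a hsG
    · rintro _ ⟨z, hz, rfl⟩
      rw [smul_eq_mul]
      exact hZG z hz
  rw [← hMG, lengthAt_quotient_map_eq_add C.colMap (C.colMap_injective Lsharp Lflat hSP hcol) C.Z 𝔭]

/-- **Zeta-index cap, print keying: `k ≤ m^•`** at every height-one `𝔭`. [cite: Sprung2012, Thm. 7.14 (3) (p. 1504)]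
[cite: Kato2004Asterisque, Thm. 12.5 (p. 222)] -/
theorem _root_.Literature.NumberTheory.EllipticCurves.Sprung2012.SharpFlatColemanKatoDataContra.lengthAt_quotient_zeta_le_lengthAt_quotient_span
    {col : Chroma} (C : SharpFlatColemanKatoDataContra W p f ϖ κ γ ι ap g c col I)
    (hirr : W.HasIrreducibleModPGaloisRep p) {Lsharp Lflat G₁ : IwasawaAlgebra p}
    (hSP : IsSprungPair f p ap Lsharp Lflat) (hcol : chromaticL col Lsharp Lflat ≠ 0)
    (hG₁ : iwasawaToPowerSeries p G₁ =
      PowerSeries.C ((ϖ : ℚ) : ℚ_[p]) * iwasawaToPowerSeries p (chromaticL col Lsharp Lflat))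
    (𝔭 : PrimeSpectrum (IwasawaAlgebra p)) (h𝔭 : 𝔭.asIdeal.height = 1) :
    lengthAt (IwasawaAlgebra p) (I.H ⧸ C.Z) 𝔭 ≤
      lengthAt (IwasawaAlgebra p) (IwasawaAlgebra p ⧸ Ideal.span {G₁}) 𝔭 := by
  rw [C.lengthAt_quotient_span_eq_zeta_add_range W p hirr hSP hcol hG₁ 𝔭 h𝔭]
  exact le_self_add

/-- The zeta index of a contragredient package is FINITE at every height-one prime (`k ≤ m^• < ⊤` for a non-zero normalised colour).
[cite: Sprung2012, Thm. 7.14 (3) (p. 1504)] -/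
theorem _root_.Literature.NumberTheory.EllipticCurves.Sprung2012.SharpFlatColemanKatoDataContra.lengthAt_quotient_zeta_ne_top
    {col : Chroma} (C : SharpFlatColemanKatoDataContra W p f ϖ κ γ ι ap g c col I)
    (hirr : W.HasIrreducibleModPGaloisRep p) {Lsharp Lflat G₁ : IwasawaAlgebra p}
    (hSP : IsSprungPair f p ap Lsharp Lflat) (hcol : chromaticL col Lsharp Lflat ≠ 0)
    (hG₁ : iwasawaToPowerSeries p G₁ =
      PowerSeries.C ((ϖ : ℚ) : ℚ_[p]) * iwasawaToPowerSeries p (chromaticL col Lsharp Lflat))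
    (hG0 : G₁ ≠ 0) (𝔭 : PrimeSpectrum (IwasawaAlgebra p)) (h𝔭 : 𝔭.asIdeal.height = 1) :
    lengthAt (IwasawaAlgebra p) (I.H ⧸ C.Z) 𝔭 ≠ ⊤ :=
  ne_top_of_le_ne_top (lengthAt_ne_top_of_isTorsionBy hG0 (isTorsionBy_quotient_span_singleton G₁) 𝔭 (le_of_eq h𝔭))
    (C.lengthAt_quotient_zeta_le_lengthAt_quotient_span W p hirr hSP hcol hG₁ 𝔭 h𝔭)

/-! ### §2 The `ι`-door at one prime (contragredient packages, natural-keyed fine datum) -/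

/-- **If some non-vanishing normalised colour misses `𝔮`, the local index at `𝔮` vanishes** (Contra twin of
`localIndex_eq_zero_of_normalised_not_mem`): `min(c♯, c♭)(𝔮) = 0` from `m^{•'} = k + c^{•'}` with `m^{•'}(𝔮) = 0`.
[cite: Sprung2012, Def. 6.1, Thm. 7.14 (3) (p. 1504)] [cite: Kato2004Asterisque, Thm. 12.6 (p. 222)] -/
theorem localIndex_eq_zero_of_normalised_not_mem_contra
    (Cs : SharpFlatColemanKatoDataContra W p f ϖ κ γ ι ap g c Chroma.sharp I)
    (Cf : SharpFlatColemanKatoDataContra W p f ϖ κ γ ι ap g c Chroma.flat I)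
    (hirr : W.HasIrreducibleModPGaloisRep p) {Lsharp Lflat : IwasawaAlgebra p}
    (hSP : IsSprungPair f p ap Lsharp Lflat) (hs : chromaticL Chroma.sharp Lsharp Lflat ≠ 0)
    (hfl : chromaticL Chroma.flat Lsharp Lflat ≠ 0)
    (𝔮 : PrimeSpectrum (IwasawaAlgebra p)) (h𝔮 : 𝔮.asIdeal.height = 1)
    {col' : Chroma} {G' : IwasawaAlgebra p}
    (hG' : iwasawaToPowerSeries p G' =
      PowerSeries.C ((ϖ : ℚ) : ℚ_[p]) * iwasawaToPowerSeries p (chromaticL col' Lsharp Lflat))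
    (hG'𝔮 : G' ∉ 𝔮.asIdeal) :
    min (Module.lengthAt (IwasawaAlgebra p) (IwasawaAlgebra p ⧸ LinearMap.range Cs.colMap) 𝔮)
        (Module.lengthAt (IwasawaAlgebra p) (IwasawaAlgebra p ⧸ LinearMap.range Cf.colMap) 𝔮) = 0 := by
  have hm0 : Module.lengthAt (IwasawaAlgebra p) (IwasawaAlgebra p ⧸ Ideal.span {G'}) 𝔮 = 0 :=
    (lengthAt_quotient_span_eq_zero_iff_not_mem G' 𝔮).mpr hG'𝔮
  refine le_antisymm ?_ bot_le
  cases col' with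
  | sharp =>
    have h := Cs.lengthAt_quotient_span_eq_zeta_add_range W p hirr hSP hs hG' 𝔮 h𝔮
    rw [hm0] at h
    calc min (Module.lengthAt (IwasawaAlgebra p) (IwasawaAlgebra p ⧸ LinearMap.range Cs.colMap) 𝔮)
          (Module.lengthAt (IwasawaAlgebra p) (IwasawaAlgebra p ⧸ LinearMap.range Cf.colMap) 𝔮)
        ≤ Module.lengthAt (IwasawaAlgebra p) (IwasawaAlgebra p ⧸ LinearMap.range Cs.colMap) 𝔮 := min_le_left _ _
      _ ≤ Module.lengthAt (IwasawaAlgebra p) (I.H ⧸ Cs.Z) 𝔮 +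
          Module.lengthAt (IwasawaAlgebra p) (IwasawaAlgebra p ⧸ LinearMap.range Cs.colMap) 𝔮 := le_add_self
      _ = 0 := h.symm
  | flat =>
    have h := Cf.lengthAt_quotient_span_eq_zeta_add_range W p hirr hSP hfl hG' 𝔮 h𝔮
    rw [hm0] at h
    calc min (Module.lengthAt (IwasawaAlgebra p) (IwasawaAlgebra p ⧸ LinearMap.range Cs.colMap) 𝔮)
          (Module.lengthAt (IwasawaAlgebra p) (IwasawaAlgebra p ⧸ LinearMap.range Cf.colMap) 𝔮)
        ≤ Module.lengthAt (IwasawaAlgebra p) (IwasawaAlgebra p ⧸ LinearMap.range Cf.colMap) 𝔮 := min_le_right _ _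
      _ ≤ Module.lengthAt (IwasawaAlgebra p) (I.H ⧸ Cf.Z) 𝔮 +
          Module.lengthAt (IwasawaAlgebra p) (IwasawaAlgebra p ⧸ LinearMap.range Cf.colMap) 𝔮 := le_add_self
      _ = 0 := h.symm

/-- **THE `ι`-DOOR AT ONE PRIME, print keying.** Contragredient joint package `Cs, Cf`, both colours non-zero, `E[p]` irreducible;
a natural-keyed fine dual datum `Y′ : FineSelmerDualData κ γ⁻¹`; primes `𝔭` (target) and `𝔮` (height one; in the line `𝔮 = ι𝔭`).
IF (hFα) «whenever every normalised colour vanishes at `𝔮`, `j(𝔮) ≤ x′(𝔭)`» (= F-α♮′ at `𝔮 = ι𝔭`: `j(ι𝔭) ≤ x′(ιι𝔭) = x′(𝔭)`, Matar's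
dot) and (hdoor) «`k(𝔭) ≤ j(𝔮)`», THEN `k(𝔭) ≤ x′(𝔭)` — K_spor′ at `𝔭` in print keying (Kato 12.10 ⊆ at the same prime).
If `𝔮` is not a common zero, `j(𝔮) = 0` and the door forces `k(𝔭) = 0`. Pure transitivity.
[cite: Kato2004Asterisque, Conj. 12.10 (p. 224), (17.13.1) (p. 280)] [cite: Sprung2012, §7.1, Props. 7.3/7.6, Thm. 7.14 (3)]
[cite: Matar2020, Thm. 1.1] [cite: Wingberg1989, Cor. 2.5] -/
theorem katoFineLowerAt_of_iotaDoor_contra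
    (Cs : SharpFlatColemanKatoDataContra W p f ϖ κ γ ι ap g c Chroma.sharp I)
    (Cf : SharpFlatColemanKatoDataContra W p f ϖ κ γ ι ap g c Chroma.flat I)
    (hirr : W.HasIrreducibleModPGaloisRep p) {Lsharp Lflat : IwasawaAlgebra p}
    (hSP : IsSprungPair f p ap Lsharp Lflat) (hs : chromaticL Chroma.sharp Lsharp Lflat ≠ 0)
    (hfl : chromaticL Chroma.flat Lsharp Lflat ≠ 0)
    (Y : W.FineSelmerDualData κ γ⁻¹) (𝔭 𝔮 : PrimeSpectrum (IwasawaAlgebra p)) (h𝔮 : 𝔮.asIdeal.height = 1)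
    (hFα : (∀ (col' : Chroma) (G' : IwasawaAlgebra p),
        iwasawaToPowerSeries p G' =
          PowerSeries.C ((ϖ : ℚ) : ℚ_[p]) * iwasawaToPowerSeries p (chromaticL col' Lsharp Lflat) →
        G' ∈ 𝔮.asIdeal) →
      min (Module.lengthAt (IwasawaAlgebra p) (IwasawaAlgebra p ⧸ LinearMap.range Cs.colMap) 𝔮)
          (Module.lengthAt (IwasawaAlgebra p) (IwasawaAlgebra p ⧸ LinearMap.range Cf.colMap) 𝔮) ≤
        Module.lengthAt (IwasawaAlgebra p) Y.X 𝔭)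
    (hdoor : Module.lengthAt (IwasawaAlgebra p) (I.H ⧸ Cs.Z) 𝔭 ≤
      min (Module.lengthAt (IwasawaAlgebra p) (IwasawaAlgebra p ⧸ LinearMap.range Cs.colMap) 𝔮)
          (Module.lengthAt (IwasawaAlgebra p) (IwasawaAlgebra p ⧸ LinearMap.range Cf.colMap) 𝔮)) :
    Module.lengthAt (IwasawaAlgebra p) (I.H ⧸ Cs.Z) 𝔭 ≤ Module.lengthAt (IwasawaAlgebra p) Y.X 𝔭 := by
  by_cases hcommon : ∀ (col' : Chroma) (G' : IwasawaAlgebra p),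
      iwasawaToPowerSeries p G' =
        PowerSeries.C ((ϖ : ℚ) : ℚ_[p]) * iwasawaToPowerSeries p (chromaticL col' Lsharp Lflat) →
      G' ∈ 𝔮.asIdeal
  · exact hdoor.trans (hFα hcommon)
  · push Not at hcommon
    obtain ⟨col', G', hG', hG'𝔮⟩ := hcommon
    rw [localIndex_eq_zero_of_normalised_not_mem_contra W p Cs Cf hirr hSP hs hfl 𝔮 h𝔮 hG' hG'𝔮] at hdoor
    exact hdoor.trans bot_le

/-- **At an `ι`-FIXED prime the Contra `ι`-door is the ledger door** (`ι𝔭 = 𝔭`: `(T)`, `(p)`, every positive-level cyclotomic prime):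
F-α♮′ at `𝔭` and `k(𝔭) ≤ j(𝔭)` give `k(𝔭) ≤ x′(𝔭)`. [cite: Kato2004Asterisque, Conj. 12.10 (p. 224)] [cite: Sprung2012, Main Conj. 7.21 (p. 1505)] -/
theorem katoFineLowerAt_of_iotaDoor_contra_of_comap_invol_eq
    (Cs : SharpFlatColemanKatoDataContra W p f ϖ κ γ ι ap g c Chroma.sharp I)
    (Cf : SharpFlatColemanKatoDataContra W p f ϖ κ γ ι ap g c Chroma.flat I)
    (hirr : W.HasIrreducibleModPGaloisRep p) {Lsharp Lflat : IwasawaAlgebra p}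
    (hSP : IsSprungPair f p ap Lsharp Lflat) (hs : chromaticL Chroma.sharp Lsharp Lflat ≠ 0)
    (hfl : chromaticL Chroma.flat Lsharp Lflat ≠ 0)
    (Y : W.FineSelmerDualData κ γ⁻¹) (𝔭 : PrimeSpectrum (IwasawaAlgebra p)) (h𝔭 : 𝔭.asIdeal.height = 1)
    (hfix : PrimeSpectrum.comap (invol p).toRingHom 𝔭 = 𝔭)
    (hFα : (∀ (col' : Chroma) (G' : IwasawaAlgebra p),
        iwasawaToPowerSeries p G' =
          PowerSeries.C ((ϖ : ℚ) : ℚ_[p]) * iwasawaToPowerSeries p (chromaticL col' Lsharp Lflat) →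
        G' ∈ 𝔭.asIdeal) →
      min (Module.lengthAt (IwasawaAlgebra p) (IwasawaAlgebra p ⧸ LinearMap.range Cs.colMap) 𝔭)
          (Module.lengthAt (IwasawaAlgebra p) (IwasawaAlgebra p ⧸ LinearMap.range Cf.colMap) 𝔭) ≤
        Module.lengthAt (IwasawaAlgebra p) Y.X (PrimeSpectrum.comap (invol p).toRingHom 𝔭))
    (hkj : Module.lengthAt (IwasawaAlgebra p) (I.H ⧸ Cs.Z) 𝔭 ≤
      min (Module.lengthAt (IwasawaAlgebra p) (IwasawaAlgebra p ⧸ LinearMap.range Cs.colMap) 𝔭)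
          (Module.lengthAt (IwasawaAlgebra p) (IwasawaAlgebra p ⧸ LinearMap.range Cf.colMap) 𝔭)) :
    Module.lengthAt (IwasawaAlgebra p) (I.H ⧸ Cs.Z) 𝔭 ≤ Module.lengthAt (IwasawaAlgebra p) Y.X 𝔭 := by
  rw [hfix] at hFα
  exact katoFineLowerAt_of_iotaDoor_contra W p Cs Cf hirr hSP hs hfl Y 𝔭 𝔭 h𝔭 hFα hkj

end Package

/-! ### §3 The off-`(T)` composition, print keying: `k(𝔭) ≤ x′(𝔭)` at every height-one common zero `𝔭 ∌ p, T` from F-α♮′ ∧ R♮′ -/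

/-- **`k ≤ x′` OFF `(T)` FROM F-α♮′ ∧ R♮′, print keying** (Contra twin of `katoFineLowerOffT_of_iotaDoor`; the shared composition of a C′
ι-door skeleton). Over the C′ binders (X8 pair, cyclotomic/Honda setting, newform and Sprung pair, the CONTRAGREDIENT joint package
`I, Cs, Cf` with `Cs.Z = Cf.Z`, a natural-keyed fine dual datum `Y′`) and a height-one `𝔭 ∌ p, T` at which every normalised colour vanishes:
* (hFα) **F-α♮′** = the conclusion of `cokerBoundIotaOffT_contra_of_poitouTate` VERBATIM: `min_• ℓ_𝔭(Λ ⧸ range C•.colMap) ≤ ℓ_{ι𝔭} Y′.X`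
  (print: (SES-KP) + Poitou–Tate + Kato 12.4 + Matar's `Ṫ_Λ(X) ∼ X₀` — the `ι` is Matar's dot; closed modulo named facts by w2 g9/g10 + w3 g9);
* (hres) **R♮′**: «`ℓ_𝔭(I.H ⧸ Cs.Z) ≤ ℓ_𝔭 Y′.X` whenever `min_• ℓ_{ι𝔭}(Λ ⧸ range C•.colMap) < ℓ_𝔭(I.H ⧸ Cs.Z)`» — research (Kato Conj. 12.10 ⊆ /
  Sprung Main Conj. 7.21 ⊆ at such primes; OPEN in print at `(3, a₃ = ±3)`);
THEN `ℓ_𝔭(I.H ⧸ Cs.Z) ≤ ℓ_𝔭 Y′.X`. Proof: at `ι𝔭` either the residue hypothesis holds, or `k(𝔭) ≤ j(ι𝔭)` and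
`katoFineLowerAt_of_iotaDoor_contra` applies with F-α♮′ AT `ι𝔭`. Nothing is discharged.
[cite: Kato2004Asterisque, Conj. 12.10 (p. 224), (17.13.1) (p. 280)] [cite: Sprung2012, §7.1, Props. 7.3/7.6, Prop. 7.19, Main Conj. 7.21 (p. 1505)]
[cite: KuriharaPollack2007, Prop. 1.2] [cite: LeiSujatha2021, §3] [cite: Wingberg1989, Cor. 2.5] [cite: Matar2020, Thm. 1.1] -/
theorem katoFineLowerOffT_of_iotaDoor_contra
    (hFα : ∀ (W : WeierstrassCurve ℚ) [W.IsElliptic] [W.IsGloballyMinimal] (p : ℕ) [Fact p.Prime]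
      [ContinuousSMul ℤ_[p] (W.tateModule p)] [Module.Free ℤ_[p] (W.tateModule p)]
      [Module.Finite ℤ_[p] (W.tateModule p)],
      ClassX8 W p → ∀ (κ : ZpExtension ℚ p) (γ : Field.absoluteGaloisGroup ℚ),
      κ.IsCyclotomic → κ.IsTopGenerator γ → IsCyclotomicVariable p γ →
    ∀ (v : HeightOneSpectrum (𝓞 ℚ)), (p : 𝓞 ℚ) ∈ v.asIdeal →
    ∀ (g : Field.absoluteGaloisGroup (v.adicCompletion ℚ)),
      κ.IsTopGenerator (resGalOfEmb (closureEmb (K := ℚ) (v.adicCompletion ℚ)) g) →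
    ∀ (cneg : localPoints W (v.adicCompletion ℚ)) (c : ℕ → localPoints W (v.adicCompletion ℚ)),
      IsHondaSystem κ (closureEmb (K := ℚ) (v.adicCompletion ℚ)) W (W.frobeniusTrace p) g cneg c →
    ∀ (N : ℕ) (_ : NeZero N) (f : CuspForm (Gamma0 N) 2) (ϖ : ℚ) (Lsharp Lflat : IwasawaAlgebra p),
      IsNewformOf W f → (ϖ : ℝ) * W.realPeriodRat = plusPeriod f →
      IsSprungPair f p (W.frobeniusTrace p) Lsharp Lflat →
    ∀ (I : Kato2004.IwasawaH1Data W p κ γ)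
      (Cs : SharpFlatColemanKatoDataContra W p f ϖ κ γ (closureEmb (K := ℚ) (v.adicCompletion ℚ))
        (W.frobeniusTrace p) g c Chroma.sharp I)
      (Cf : SharpFlatColemanKatoDataContra W p f ϖ κ γ (closureEmb (K := ℚ) (v.adicCompletion ℚ))
        (W.frobeniusTrace p) g c Chroma.flat I),
      Cs.Z = Cf.Z →
    ∀ (Y : W.FineSelmerDualData κ γ⁻¹) (𝔭 : PrimeSpectrum (IwasawaAlgebra p)), 𝔭.asIdeal.height = 1 →
      (p : IwasawaAlgebra p) ∉ 𝔭.asIdeal → (PowerSeries.X : IwasawaAlgebra p) ∉ 𝔭.asIdeal →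
      (∀ (col' : Chroma) (G' : IwasawaAlgebra p),
        iwasawaToPowerSeries p G' =
          PowerSeries.C (ϖ : ℚ_[p]) * iwasawaToPowerSeries p (chromaticL col' Lsharp Lflat) →
        G' ∈ 𝔭.asIdeal) →
      min (Module.lengthAt (IwasawaAlgebra p) (IwasawaAlgebra p ⧸ LinearMap.range Cs.colMap) 𝔭)
          (Module.lengthAt (IwasawaAlgebra p) (IwasawaAlgebra p ⧸ LinearMap.range Cf.colMap) 𝔭) ≤
        Module.lengthAt (IwasawaAlgebra p) Y.X (PrimeSpectrum.comap (invol p).toRingHom 𝔭))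
    (hres : ∀ (W : WeierstrassCurve ℚ) [W.IsElliptic] [W.IsGloballyMinimal] (p : ℕ) [Fact p.Prime]
      [ContinuousSMul ℤ_[p] (W.tateModule p)] [Module.Free ℤ_[p] (W.tateModule p)]
      [Module.Finite ℤ_[p] (W.tateModule p)],
      ClassX8 W p → ∀ (κ : ZpExtension ℚ p) (γ : Field.absoluteGaloisGroup ℚ),
      κ.IsCyclotomic → κ.IsTopGenerator γ → IsCyclotomicVariable p γ →
    ∀ (v : HeightOneSpectrum (𝓞 ℚ)), (p : 𝓞 ℚ) ∈ v.asIdeal →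
    ∀ (g : Field.absoluteGaloisGroup (v.adicCompletion ℚ)),
      κ.IsTopGenerator (resGalOfEmb (closureEmb (K := ℚ) (v.adicCompletion ℚ)) g) →
    ∀ (cneg : localPoints W (v.adicCompletion ℚ)) (c : ℕ → localPoints W (v.adicCompletion ℚ)),
      IsHondaSystem κ (closureEmb (K := ℚ) (v.adicCompletion ℚ)) W (W.frobeniusTrace p) g cneg c →
    ∀ (N : ℕ) (_ : NeZero N) (f : CuspForm (Gamma0 N) 2) (ϖ : ℚ) (Lsharp Lflat : IwasawaAlgebra p),
      IsNewformOf W f → (ϖ : ℝ) * W.realPeriodRat = plusPeriod f →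
      IsSprungPair f p (W.frobeniusTrace p) Lsharp Lflat →
    ∀ (I : Kato2004.IwasawaH1Data W p κ γ)
      (Cs : SharpFlatColemanKatoDataContra W p f ϖ κ γ (closureEmb (K := ℚ) (v.adicCompletion ℚ))
        (W.frobeniusTrace p) g c Chroma.sharp I)
      (Cf : SharpFlatColemanKatoDataContra W p f ϖ κ γ (closureEmb (K := ℚ) (v.adicCompletion ℚ))
        (W.frobeniusTrace p) g c Chroma.flat I),
      Cs.Z = Cf.Z →
    ∀ (Y : W.FineSelmerDualData κ γ⁻¹) (𝔭 : PrimeSpectrum (IwasawaAlgebra p)), 𝔭.asIdeal.height = 1 →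
      (p : IwasawaAlgebra p) ∉ 𝔭.asIdeal → (PowerSeries.X : IwasawaAlgebra p) ∉ 𝔭.asIdeal →
      (∀ (col' : Chroma) (G' : IwasawaAlgebra p),
        iwasawaToPowerSeries p G' =
          PowerSeries.C (ϖ : ℚ_[p]) * iwasawaToPowerSeries p (chromaticL col' Lsharp Lflat) →
        G' ∈ 𝔭.asIdeal) →
      min (Module.lengthAt (IwasawaAlgebra p) (IwasawaAlgebra p ⧸ LinearMap.range Cs.colMap)
            (PrimeSpectrum.comap (invol p).toRingHom 𝔭))
          (Module.lengthAt (IwasawaAlgebra p) (IwasawaAlgebra p ⧸ LinearMap.range Cf.colMap)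
            (PrimeSpectrum.comap (invol p).toRingHom 𝔭)) <
          Module.lengthAt (IwasawaAlgebra p) (I.H ⧸ Cs.Z) 𝔭 →
      Module.lengthAt (IwasawaAlgebra p) (I.H ⧸ Cs.Z) 𝔭 ≤ Module.lengthAt (IwasawaAlgebra p) Y.X 𝔭) :
    ∀ (W : WeierstrassCurve ℚ) [W.IsElliptic] [W.IsGloballyMinimal] (p : ℕ) [Fact p.Prime]
      [ContinuousSMul ℤ_[p] (W.tateModule p)] [Module.Free ℤ_[p] (W.tateModule p)]
      [Module.Finite ℤ_[p] (W.tateModule p)],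
      ClassX8 W p → ∀ (κ : ZpExtension ℚ p) (γ : Field.absoluteGaloisGroup ℚ),
      κ.IsCyclotomic → κ.IsTopGenerator γ → IsCyclotomicVariable p γ →
    ∀ (v : HeightOneSpectrum (𝓞 ℚ)), (p : 𝓞 ℚ) ∈ v.asIdeal →
    ∀ (g : Field.absoluteGaloisGroup (v.adicCompletion ℚ)),
      κ.IsTopGenerator (resGalOfEmb (closureEmb (K := ℚ) (v.adicCompletion ℚ)) g) →
    ∀ (cneg : localPoints W (v.adicCompletion ℚ)) (c : ℕ → localPoints W (v.adicCompletion ℚ)),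
      IsHondaSystem κ (closureEmb (K := ℚ) (v.adicCompletion ℚ)) W (W.frobeniusTrace p) g cneg c →
    ∀ (N : ℕ) (_ : NeZero N) (f : CuspForm (Gamma0 N) 2) (ϖ : ℚ) (Lsharp Lflat : IwasawaAlgebra p),
      IsNewformOf W f → (ϖ : ℝ) * W.realPeriodRat = plusPeriod f →
      IsSprungPair f p (W.frobeniusTrace p) Lsharp Lflat →
    ∀ (I : Kato2004.IwasawaH1Data W p κ γ)
      (Cs : SharpFlatColemanKatoDataContra W p f ϖ κ γ (closureEmb (K := ℚ) (v.adicCompletion ℚ))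
        (W.frobeniusTrace p) g c Chroma.sharp I)
      (Cf : SharpFlatColemanKatoDataContra W p f ϖ κ γ (closureEmb (K := ℚ) (v.adicCompletion ℚ))
        (W.frobeniusTrace p) g c Chroma.flat I),
      Cs.Z = Cf.Z →
    ∀ (Y : W.FineSelmerDualData κ γ⁻¹) (𝔭 : PrimeSpectrum (IwasawaAlgebra p)), 𝔭.asIdeal.height = 1 →
      (p : IwasawaAlgebra p) ∉ 𝔭.asIdeal → (PowerSeries.X : IwasawaAlgebra p) ∉ 𝔭.asIdeal →
      (∀ (col' : Chroma) (G' : IwasawaAlgebra p),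
        iwasawaToPowerSeries p G' =
          PowerSeries.C (ϖ : ℚ_[p]) * iwasawaToPowerSeries p (chromaticL col' Lsharp Lflat) →
        G' ∈ 𝔭.asIdeal) →
      Module.lengthAt (IwasawaAlgebra p) (I.H ⧸ Cs.Z) 𝔭 ≤ Module.lengthAt (IwasawaAlgebra p) Y.X 𝔭 := by
  intro W _ _ p _ _ _ _ hX κ γ hκ hγ hcv v hv g hg cneg c hH N hN f ϖ Lsharp Lflat hf hϖ hSP I Cs Cf hZ Y 𝔭 h𝔭
    hp𝔭 hT hcommon
  haveI : NeZero N := hN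
  -- the mirror prime `𝔮 = ι𝔭`: height one, `p ∉ 𝔮`, `T ∉ 𝔮`
  obtain ⟨h𝔮, hp𝔮⟩ := comap_invol_heightOne_not_mem 𝔭 h𝔭 hp𝔭
  have hT𝔮 := X_not_mem_comap_invol 𝔭 hT
  by_cases hlt :
      min (Module.lengthAt (IwasawaAlgebra p) (IwasawaAlgebra p ⧸ LinearMap.range Cs.colMap)
            (PrimeSpectrum.comap (invol p).toRingHom 𝔭))
          (Module.lengthAt (IwasawaAlgebra p) (IwasawaAlgebra p ⧸ LinearMap.range Cf.colMap)
            (PrimeSpectrum.comap (invol p).toRingHom 𝔭)) <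
        Module.lengthAt (IwasawaAlgebra p) (I.H ⧸ Cs.Z) 𝔭
  · -- the `ι`-residue R♮′
    exact hres W p hX κ γ hκ hγ hcv v hv g hg cneg c hH N hN f ϖ Lsharp Lflat hf hϖ hSP I Cs Cf hZ Y 𝔭 h𝔭 hp𝔭 hT
      hcommon hlt
  · -- the `ι`-door: `k(𝔭) ≤ j(ι𝔭) ≤ x′(ιι𝔭) = x′(𝔭)`
    have hs : chromaticL Chroma.sharp Lsharp Lflat ≠ 0 :=
      ChromaticBothColours.ClassX8.chromaticL_ne_zero W p hX f Lsharp Lflat hf hSP Chroma.sharp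
    have hfl : chromaticL Chroma.flat Lsharp Lflat ≠ 0 :=
      ChromaticBothColours.ClassX8.chromaticL_ne_zero W p hX f Lsharp Lflat hf hSP Chroma.flat
    refine katoFineLowerAt_of_iotaDoor_contra W p Cs Cf (ClassX8.irr' W p hX) hSP hs hfl Y 𝔭
      (PrimeSpectrum.comap (invol p).toRingHom 𝔭) h𝔮 ?_ (not_lt.mp hlt)
    intro hcommon𝔮
    have h := hFα W p hX κ γ hκ hγ hcv v hv g hg cneg c hH N hN f ϖ Lsharp Lflat hf hϖ hSP I Cs Cf hZ Y
      (PrimeSpectrum.comap (invol p).toRingHom 𝔭) h𝔮 hp𝔮 hT𝔮 hcommon𝔮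
    rwa [Kato2004.comap_invol_comap_invol] at h

end Summit.BirchSwinnertonDyer.BirchSwinnertonDyer.Theorems.ChromaticCommonZeros

end
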